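import Summits.Ventures.HodgeRepro.Night3GSetWeilModelKP

/-!
# The concrete Weil space has dimension `|G|` (the lines are a basis), and the concrete model is inhabited

Blind re-derivation cell `pub-hodge-repro`, seat `night-3` (gen 4).  Imports night-3's `Night3GSetWeilModelKP` (the
concrete model on `H M = ⋀^{|M|} ℂ^{Fin |M| × G}`, the lines `line n σ`, `weilSpace M`, the honest instance
`gsetModelKP`).
Namespace `HodgeRepro.Night3.GSetModel`.

* `lineSet_injective` / **`linearIndependent_line`** — for `n ≥ 1` the `σ`-lines are pairwise distinct basis vectors of
  the lex-ordered wedge basis (`wedgeBasis_lineSet`), hence linearly independent (night-1's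
  `linearIndependent_weilWedgeProd` by dual functionals; here by the basis); for `n = 0` every line is the empty wedge.
* **`finrank_weilSpace`** — `dim_ℂ W_M = |G| = 2m` for every non-empty `M`: the concrete Weil space has the dimension
  ROUTE.md §3.6 ascribes to `W_F(B_M)` (`[F : ℚ] = 2m`), gen 2's `finrank_weil` on the concrete model.
* **`gsetModelKP_top`** — the concrete model with `Alg = ⊤` (every class algebraic) and the coordinate form
  `Q = Σ_S x_S y_S` of the wedge basis (`hQ`: `Q (ℓ_σ, ℓ_σ) = 1`) IS a Weil model with projection and product: the
  fields are consistent, the structure `gsetModelKP` is inhabited (gen 2's `WeilModel.nonempty` for the concrete model).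

Nothing here says anything about the status of the Hodge conjecture for CM abelian varieties, which is NOT proved.
-/

set_option autoImplicit false

open Finset Module TensorProduct

namespace HodgeRepro.Night3.GSetModel

open HodgeRepro.CMHodgeOn

universe u

section Dim

variable {G : Type u} [Fintype G] [DecidableEq G] [LinearOrder G]

omit [Fintype G] [DecidableEq G] [LinearOrder G] in
/-- For `n ≥ 1` the line sets of distinct `σ` are distinct. -/
theorem lineSet_injective {n : ℕ} (hn : 0 < n) : Function.Injective (lineSet (G := G) n) := by
  intro σ τ h
  have hmem : toLex ((⟨0, hn⟩ : Fin n), σ) ∈ (lineSet n τ : Finset (Lex (Fin n × G))) := by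
    rw [← h, mem_lineSet_iff]
    rfl
  have h2 : (ofLex (toLex ((⟨0, hn⟩ : Fin n), σ))).2 = τ := (mem_lineSet_iff n τ _).mp hmem
  exact h2

/-- **The lines are linearly independent** (`n ≥ 1`): they are distinct vectors of the wedge basis. -/
theorem linearIndependent_line {n : ℕ} (hn : 0 < n) : LinearIndependent ℂ (line (G := G) n) := by
  have h : line (G := G) n = wedgeBasis n ∘ lineSet n := by
    funext σ
    exact (wedgeBasis_lineSet n σ).symm
  rw [h]
  exact (wedgeBasis n).linearIndependent.comp (lineSet n) (lineSet_injective hn)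

/-- **`dim W_M = |G|`** for every non-empty `M`: the concrete Weil space is `|G| = 2m`-dimensional (ROUTE.md §3.6). -/
theorem finrank_weilSpace (M : Multiset (Finset G)) (hM : M ≠ 0) :
    Module.finrank ℂ (weilSpace M) = Fintype.card G := by
  rw [weilSpace]
  exact finrank_span_eq_card (linearIndependent_line (Multiset.card_pos.mpr hM))

/-- The coordinate form of the wedge basis, `Q (x, y) = Σ_S x_S y_S`. -/
noncomputable def coordForm (n : ℕ) : LinearMap.BilinForm ℂ (Hn G n) :=
  ∑ S : Set.powersetCard (Lex (Fin n × G)) n,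
    LinearMap.mk₂ ℂ (fun x y => (wedgeBasis n).coord S x * (wedgeBasis n).coord S y)
      (fun _ _ _ => by simp [add_mul]) (fun _ _ _ => by simp [mul_assoc])
      (fun _ _ _ => by simp [mul_add]) (fun _ _ _ => by simp [mul_left_comm])

omit [DecidableEq G] in
/-- `coordForm` on two basis vectors is `1` on the diagonal. -/
theorem coordForm_wedgeBasis_self (n : ℕ) (S : Set.powersetCard (Lex (Fin n × G)) n) :
    coordForm n (wedgeBasis n S) (wedgeBasis n S) = 1 := by
  simp only [coordForm, LinearMap.coe_sum, Finset.sum_apply, LinearMap.mk₂_apply, Basis.coord_apply,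
    Basis.repr_self]
  rw [Finset.sum_eq_single S]
  · simp
  · intro T _ hTS
    simp [Ne.symm hTS]
  · intro h
    exact absurd (Finset.mem_univ S) h

/-- `coordForm (ℓ_σ, ℓ_σ) = 1`: the field `hQ` holds for the coordinate form. -/
theorem coordForm_line_self (n : ℕ) (σ : G) : coordForm n (line n σ) (line n σ) = 1 := by
  rw [← wedgeBasis_lineSet, coordForm_wedgeBasis_self]

/-- **The concrete model is inhabited**: with `Alg = ⊤` and the coordinate form all the fields hold. -/
noncomputable def gsetModelKP_top : WeilModelKP ℂ ℂ G (Multiset (Finset G)) :=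
  gsetModelKP (fun _ => ⊤) (fun M => coordForm (Multiset.card M)) (fun _ _ => le_top) (fun _ _ _ _ => le_top)
    (fun N _ σ => ⟨σ, by rw [coordForm_line_self]; exact one_ne_zero⟩)

/-- The `G`-set Weil models (with projection and product) are non-empty. -/
theorem gsetModelKP_nonempty : Nonempty (WeilModelKP.{u} ℂ ℂ G (Multiset (Finset G))) := ⟨gsetModelKP_top⟩

end Dim

end HodgeRepro.Night3.GSetModel
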